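import Literature.MeasureTheory.Group.InvariantQuotientExistence
import Literature.MeasureTheory.Group.InvariantQuotientUnfolding
import Mathlib.Analysis.Normed.Group.FunctionSeries
import Mathlib.Topology.Compactness.SigmaCompact
import HarnessLib

/-!
# Bruhat functions for a closed subgroup

Topic `MeasureTheory/Group`; namespace `Literature.MeasureTheory.Group`. For a closed subgroup `H`
of a second countable locally compact Hausdorff group `G` and a left Haar measure `ρ` of `H`
(left invariant, finite on compacts, positive on opens), a **Bruhat function** is a continuous
`β : G → [0, ∞)` with `∫_H β(g h) dρ(h) = 1` for every `g` (`IsBruhatFunction`; Bourbaki,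
*Intégration* VII §2 no. 4; Folland (1995), Prop. 2.48 / proof of Thm. 2.49; the support condition
of Bourbaki's definition is not needed for the uses below and is not recorded). Proved here:

* `exists_cutoff_fiberIntegral_pos` — for compact `C ⊆ G ⧸ H` a cut-off `η ∈ C_c(G)`,
  `0 ≤ η ≤ 1`, with `η^H > 0` on `C` (the step of Deitmar–Echterhoff's Lemma 1.5.1, from the tree's
  `exists_isCompact_image_mk_superset`);
* `exists_continuous_fiberIntegral_pos` — a continuous `f₀ ≥ 0` on `G` with integrable fibres and
  `f₀^H > 0` everywhere, `f₀^H` continuous (`f₀ = Σ_k c_k η_k` over a countable compact cover of the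
  σ-compact `G ⧸ H`, a normally convergent series);
* `exists_isBruhatFunction` — **Bruhat functions exist** (`β = f₀ / (f₀^H ∘ π)`); `bruhatFunction`
  (**definition**, a chosen one) with `isBruhatFunction_bruhatFunction`;
* `IsBruhatFunction.lintegral_eq_mul_lintegral` — **integration over the quotient through `β`**:
  for a `G`-invariant Borel measure `μ` on `G ⧸ H` finite on compacts and a Haar measure `ν` on `G`,
  `∫_{G ⧸ H} u dμ = c ∫_G β(g) u(gH) dν(g)` for Borel `u ≥ 0`, `c = unfoldingConstant H ρ μ ν`
  (Weil's formula of `InvariantQuotientUnfolding` applied to `β · (u ∘ π)`), and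
  `IsBruhatFunction.integrable_mul_comp_mk` — `β · (u ∘ π) ∈ L¹(G)` for `u ∈ L¹(G ⧸ H)`.

This turns integrals over a (possibly non-compact) homogeneous space into integrals over the group
without measurable sections.

## References

* G. B. Folland, *A Course in Abstract Harmonic Analysis* (1995), §2.6, Lemma 2.47, Prop. 2.48,
  Thm. 2.49 [Folland1995].
* A. Deitmar, S. Echterhoff, *Principles of Harmonic Analysis*, 2nd ed. (2014), Lemma 1.5.1
  [DeitmarEchterhoff2014].
* N. Bourbaki, *Intégration*, Ch. VII §2 no. 4 [folklore].
-/

noncomputable section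

open _root_.MeasureTheory _root_.MeasureTheory.Measure _root_.Topology Set Filter Function
open CompactlySupported
open scoped ENNReal NNReal Pointwise

namespace Literature.MeasureTheory.Group

attribute [-instance] Quotient.instMeasurableSpace QuotientGroup.measurableSpace

section Construction

variable {G : Type*} [Group G] [TopologicalSpace G] [IsTopologicalGroup G] [LocallyCompactSpace G]
  [SecondCountableTopology G] [T2Space G] (H : Subgroup G) [MeasurableSpace H] [BorelSpace H]
  (ρ : Measure H) [ρ.IsMulLeftInvariant] [IsFiniteMeasureOnCompacts ρ] [ρ.IsOpenPosMeasure]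
  (hH : IsClosed (H : Set G))

include hH in
/-- **A cut-off with positive fibre integrals over a given compact set of the quotient**: for every
compact `C ⊆ G ⧸ H` there is `η ∈ C_c(G)` with `0 ≤ η ≤ 1` and `η^H > 0` on `C`
(Deitmar–Echterhoff, proof of Lemma 1.5.1: `η = 1` on a compact `K ⊆ G` with `π(K) ⊇ C`).
[cite: DeitmarEchterhoff2014, Lemma 1.5.1 (proof)] -/
theorem exists_cutoff_fiberIntegral_pos {C : Set (G ⧸ H)} (hC : IsCompact C) :
    ∃ η : C_c(G, ℝ), (∀ x, 0 ≤ η x) ∧ (∀ x, η x ≤ 1) ∧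
      ∀ x ∈ C, 0 < fiberIntegral H ρ η x := by
  haveI : IsClosed (H : Set G) := hH
  obtain ⟨K, hKc, hKC⟩ := exists_isCompact_image_mk_superset H hC
  obtain ⟨η, hη1, -, hηs, hη01⟩ := exists_continuous_one_zero_of_isCompact hKc isClosed_empty
    (disjoint_empty K)
  have hη0 : ∀ x, 0 ≤ η x := fun x => (hη01 x).1
  refine ⟨⟨η, hηs⟩, hη0, fun x => (hη01 x).2, fun x hx => ?_⟩
  obtain ⟨g, hg, rfl⟩ := hKC hx
  change 0 < fiberIntegral H ρ η (QuotientGroup.mk g)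
  rw [fiberIntegral_mk]
  have hc : Continuous fun h : H => η (g * h) := η.continuous.comp (continuous_const.mul continuous_subtype_val)
  have h1 : η (g * (1 : H)) = 1 := by simpa using hη1 hg
  have hU : {h : H | 1 / 2 < η (g * h)} ∈ 𝓝 (1 : H) :=
    hc.continuousAt.preimage_mem_nhds (isOpen_lt continuous_const continuous_id |>.mem_nhds
      (by change (1:ℝ)/2 < η (g * (1 : H)); rw [h1]; norm_num))
  have hUo : IsOpen {h : H | 1 / 2 < η (g * h)} := isOpen_lt continuous_const hc
  have hUpos : 0 < ρ {h : H | 1 / 2 < η (g * h)} := hUo.measure_pos ρ ⟨1, mem_of_mem_nhds hU⟩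
  have hint : Integrable (fun h : H => η (g * h)) ρ := integrable_fiber H ρ hH η.continuous hηs g
  have hSfin : ρ {h : H | 1 / 2 < η (g * h)} < ∞ := by
    refine (measure_mono (fun h hh => ?_)).trans_lt
      (isCompact_fiberSupportBound H hH (isCompact_singleton (x := g)) hηs.isCompact).measure_lt_top
    change (h : G) ∈ ({g} : Set G)⁻¹ * tsupport η
    exact ⟨g⁻¹, by simp, g * h, subset_tsupport _ (by
      change η (g * h) ≠ 0; exact (lt_trans (by norm_num) hh).ne'), by simp⟩
  calc (0 : ℝ) < (1 / 2) * (ρ {h : H | 1 / 2 < η (g * h)}).toReal :=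
        mul_pos (by norm_num) (ENNReal.toReal_pos hUpos.ne' hSfin.ne)
    _ = ∫ h in {h : H | 1 / 2 < η (g * h)}, (1 / 2 : ℝ) ∂ρ := by
        rw [setIntegral_const, smul_eq_mul, mul_comm]; rfl
    _ ≤ ∫ h in {h : H | 1 / 2 < η (g * h)}, η (g * h) ∂ρ := by
        refine setIntegral_mono_on ?_ hint.integrableOn hUo.measurableSet fun h hh => hh.le
        exact (integrableOn_const_iff).2 (Or.inr hSfin)
    _ ≤ ∫ h, η (g * h) ∂ρ := setIntegral_le_integral hint (Eventually.of_forall fun h => hη0 _)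

include hH in
/-- **A positive-fibre function** (the raw material of a Bruhat function): there is a continuous
`f₀ : G → [0, ∞)` all of whose fibres `h ↦ f₀(g h)` are `ρ`-integrable, with
`0 < f₀^H(x) = ∫_H f₀(g h) dρ(h)` for every `x = gH`, and `f₀^H` continuous on `G ⧸ H`.
Construction: `f₀ = Σ_k c_k η_k` for cut-offs `η_k` positive over the members `K_k` of a countable
compact cover of the σ-compact space `G ⧸ H` (`exists_cutoff_fiberIntegral_pos`) and
`0 < c_k ≤ 2^{-k} / (1 + sup η_k^H)`, a normally convergent series together with the series of its
fibre integrals (Bourbaki, *Intégration* VII §2 no. 4; Folland (1995), Lemma 2.47 / Prop. 2.48 in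
the σ-compact case). [cite: Folland1995, §2.6 Lemma 2.47] -/
theorem exists_continuous_fiberIntegral_pos :
    ∃ f₀ : G → ℝ, Continuous f₀ ∧ (∀ x, 0 ≤ f₀ x) ∧
      (∀ g, Integrable (fun h : H => f₀ (g * h)) ρ) ∧
      (∀ x, 0 < fiberIntegral H ρ f₀ x) ∧ Continuous (fiberIntegral H ρ f₀) := by
  haveI : IsClosed (H : Set G) := hH
  -- a countable compact cover of `G ⧸ H`
  obtain ⟨Kc, hKc, hKU⟩ : IsSigmaCompact (Set.univ : Set (G ⧸ H)) := by
    rw [← Set.range_eq_univ.mpr (QuotientGroup.mk_surjective (s := H))]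
    exact isSigmaCompact_range (QuotientGroup.continuous_mk (N := H))
  -- cut-offs positive over each member
  choose η hη0 hη1 hηpos using fun k => exists_cutoff_fiberIntegral_pos H ρ hH (hKc k)
  -- bounds for the (continuous, compactly supported) fibre integrals `η_k^H`
  have hbdd : ∀ k, ∃ B : ℝ, 0 ≤ B ∧ ∀ x, fiberIntegral H ρ (η k) x ≤ B := by
    intro k
    obtain ⟨B, hB⟩ := (fiberCc H ρ hH (η k)).continuous.norm.bddAbove_range_of_hasCompactSupport
      (fiberCc H ρ hH (η k)).hasCompactSupport.norm
    refine ⟨max B 0, le_max_right _ _, fun x => ?_⟩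
    have := hB ⟨x, rfl⟩
    simp only [Real.norm_eq_abs] at this
    exact (le_abs_self _).trans (this.trans (le_max_left _ _))
  choose B hB0 hB using hbdd
  -- the coefficients
  set c : ℕ → ℝ := fun k => ((1 : ℝ) / 2) ^ k / (1 + B k) with hc
  have hcpos : ∀ k, 0 < c k := fun k => div_pos (pow_pos (by norm_num) k) (by linarith [hB0 k])
  have hcle : ∀ k, c k ≤ ((1 : ℝ) / 2) ^ k := fun k =>
    div_le_self (pow_nonneg (by norm_num) k) (by linarith [hB0 k])
  have hcB : ∀ k, c k * B k ≤ ((1 : ℝ) / 2) ^ k := by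
    intro k
    rw [hc, div_mul_eq_mul_div, div_le_iff₀ (by linarith [hB0 k])]
    nlinarith [pow_nonneg (show (0:ℝ) ≤ 1/2 by norm_num) k, hB0 k]
  have hgeom : Summable fun k : ℕ => ((1 : ℝ) / 2) ^ k := summable_geometric_two
  -- the function
  set f₀ : G → ℝ := fun x => ∑' k, c k * η k x with hf₀
  have hterm_nn : ∀ k x, 0 ≤ c k * η k x := fun k x => mul_nonneg (hcpos k).le (hη0 k x)
  have hterm_le : ∀ k x, ‖c k * η k x‖ ≤ ((1 : ℝ) / 2) ^ k := by
    intro k x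
    rw [Real.norm_of_nonneg (hterm_nn k x)]
    calc c k * η k x ≤ c k * 1 := mul_le_mul_of_nonneg_left (hη1 k x) (hcpos k).le
      _ ≤ ((1 : ℝ) / 2) ^ k := by rw [mul_one]; exact hcle k
  have hf₀c : Continuous f₀ := continuous_tsum (fun k => continuous_const.mul (η k).continuous) hgeom hterm_le
  have hf₀nn : ∀ x, 0 ≤ f₀ x := fun x => tsum_nonneg fun k => hterm_nn k x
  have hsumx : ∀ x, Summable fun k => c k * η k x := fun x =>
    hgeom.of_norm_bounded (fun k => hterm_le k x)
  -- fibres: termwise integrable with summable `L¹` norms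
  have hint_k : ∀ g k, Integrable (fun h : H => c k * η k (g * h)) ρ := fun g k =>
    (integrable_fiber H ρ hH (η k).continuous (η k).hasCompactSupport g).const_mul (c k)
  have hnorm_k : ∀ g k, ∫ h : H, ‖c k * η k (g * h)‖ ∂ρ = c k * fiberIntegral H ρ (η k) (QuotientGroup.mk g) := by
    intro g k
    rw [fiberIntegral_mk, ← integral_const_mul]
    exact integral_congr_ae (Eventually.of_forall fun h => Real.norm_of_nonneg (hterm_nn k _))
  have hsum_norm : ∀ g, Summable fun k => ∫ h : H, ‖c k * η k (g * h)‖ ∂ρ := by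
    intro g
    simp_rw [hnorm_k g]
    refine hgeom.of_nonneg_of_le (fun k => mul_nonneg (hcpos k).le
      (fiberIntegral_nonneg H ρ (fun y => hη0 k y) _)) fun k => ?_
    exact (mul_le_mul_of_nonneg_left (hB k _) (hcpos k).le).trans (hcB k)
  -- the fibre integral of `f₀` is the series of the fibre integrals
  have hfib : ∀ g, HasSum (fun k => c k * fiberIntegral H ρ (η k) (QuotientGroup.mk g))
      (fiberIntegral H ρ f₀ (QuotientGroup.mk g)) := by
    intro g
    have h := hasSum_integral_of_summable_integral_norm (hint_k g) (hsum_norm g)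
    rw [fiberIntegral_mk]
    refine h.congr_fun fun k => ?_
    rw [fiberIntegral_mk, ← integral_const_mul]
  have hfib_eq : ∀ g, fiberIntegral H ρ f₀ (QuotientGroup.mk g) =
      ∑' k, c k * fiberIntegral H ρ (η k) (QuotientGroup.mk g) := fun g => (hfib g).tsum_eq.symm
  have hfterm_nn : ∀ k x, 0 ≤ c k * fiberIntegral H ρ (η k) x := fun k x =>
    mul_nonneg (hcpos k).le (fiberIntegral_nonneg H ρ (fun y => hη0 k y) _)
  have hfterm_le : ∀ k x, ‖c k * fiberIntegral H ρ (η k) x‖ ≤ ((1 : ℝ) / 2) ^ k := by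
    intro k x
    rw [Real.norm_of_nonneg (hfterm_nn k x)]
    exact (mul_le_mul_of_nonneg_left (hB k _) (hcpos k).le).trans (hcB k)
  refine ⟨f₀, hf₀c, hf₀nn, fun g => ?_, fun x => ?_, ?_⟩
  · -- fibre integrability: a continuous non-negative function with finite integral
    have hmeas : AEStronglyMeasurable (fun h : H => f₀ (g * h)) ρ :=
      (hf₀c.comp (continuous_const.mul continuous_subtype_val)).aestronglyMeasurable
    refine ⟨hmeas, ?_⟩
    rw [hasFiniteIntegral_iff_ofReal (Eventually.of_forall fun h => hf₀nn _)]
    have h1 : ∀ h : H, ENNReal.ofReal (f₀ (g * h)) = ∑' k, ENNReal.ofReal (c k * η k (g * h)) :=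
      fun h => ENNReal.ofReal_tsum_of_nonneg (fun k => hterm_nn k _) (hsumx _)
    simp_rw [h1]
    have hmk : ∀ k, AEMeasurable (fun h : H => ENNReal.ofReal (c k * η k (g * h))) ρ := fun k =>
      ((continuous_const.mul ((η k).continuous.comp
        (continuous_const.mul continuous_subtype_val))).measurable.ennreal_ofReal).aemeasurable
    rw [lintegral_tsum hmk]
    have h2 : ∀ k, ∫⁻ h : H, ENNReal.ofReal (c k * η k (g * h)) ∂ρ =
        ENNReal.ofReal (c k * fiberIntegral H ρ (η k) (QuotientGroup.mk g)) := by
      intro k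
      rw [← ofReal_integral_eq_lintegral_ofReal (hint_k g k) (Eventually.of_forall fun h => hterm_nn k _),
        fiberIntegral_mk, ← integral_const_mul]
    simp_rw [h2]
    rw [← ENNReal.ofReal_tsum_of_nonneg (fun k => hfterm_nn k _) (hfib g).summable]
    exact ENNReal.ofReal_lt_top
  · -- positivity: `x` lies in some `K_k`, where the `k`-th term is positive
    obtain ⟨g, rfl⟩ := QuotientGroup.mk_surjective x
    have hx : (QuotientGroup.mk g : G ⧸ H) ∈ ⋃ k, Kc k := by rw [hKU]; exact Set.mem_univ _
    obtain ⟨k, hk⟩ := Set.mem_iUnion.1 hx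
    rw [hfib_eq]
    exact (hfib g).summable.tsum_pos (fun i => hfterm_nn i _) k (mul_pos (hcpos k) (hηpos k _ hk))
  · -- continuity of `f₀^H = Σ_k c_k η_k^H`, a normally convergent series of continuous functions
    have heq : fiberIntegral H ρ f₀ = fun x => ∑' k, c k * fiberIntegral H ρ (η k) x := by
      funext x
      obtain ⟨g, rfl⟩ := QuotientGroup.mk_surjective x
      exact hfib_eq g
    rw [heq]
    exact continuous_tsum (fun k => continuous_const.mul (fiberCc H ρ hH (η k)).continuous) hgeom hfterm_le

/-- **Bruhat functions.** A *Bruhat function* for the closed subgroup `H` of `G` (and the left Haar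
measure `ρ` of `H`) is a continuous `β : G → [0, ∞)` whose fibres `h ↦ β(g h)` are `ρ`-integrable with
`∫_H β(g h) dρ(h) = 1` for every `g ∈ G` (Bourbaki, *Intégration* VII §2 no. 4, Déf. 1 (without the
support condition, which is not needed below); Folland (1995), proof of Thm. 2.49; Reiter–Stegeman,
§8.1). [cite: Folland1995, §2.6 Prop. 2.48] -/
structure IsBruhatFunction (β : G → ℝ) : Prop where
  continuous : Continuous β
  nonneg : ∀ x, 0 ≤ β x
  integrable_fiber : ∀ g : G, Integrable (fun h : H => β (g * h)) ρ
  integral_fiber : ∀ g : G, ∫ h : H, β (g * h) ∂ρ = 1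

include hH in
/-- **Existence of Bruhat functions** for a closed subgroup of a second countable locally compact
group: `β = f₀ / (f₀^H ∘ π)` for a positive-fibre function `f₀`
(`exists_continuous_fiberIntegral_pos`). [cite: Folland1995, §2.6 Prop. 2.48] -/
theorem exists_isBruhatFunction : ∃ β : G → ℝ, IsBruhatFunction H ρ β := by
  obtain ⟨f₀, hc, hnn, hint, hpos, hcH⟩ := exists_continuous_fiberIntegral_pos H ρ hH
  refine ⟨fun x => f₀ x / fiberIntegral H ρ f₀ (QuotientGroup.mk x), ⟨?_, ?_, ?_, ?_⟩⟩
  · exact hc.div (hcH.comp (QuotientGroup.continuous_mk (N := H))) fun x => (hpos _).ne'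
  · exact fun x => div_nonneg (hnn x) (hpos _).le
  · intro g
    have heq : (fun h : H => f₀ (g * h) / fiberIntegral H ρ f₀ (QuotientGroup.mk (g * h))) =
        fun h : H => f₀ (g * h) / fiberIntegral H ρ f₀ (QuotientGroup.mk g) := by
      funext h; rw [QuotientGroup.mk_mul_of_mem g h.2]
    rw [heq]
    exact (hint g).div_const _
  · intro g
    have heq : (fun h : H => f₀ (g * h) / fiberIntegral H ρ f₀ (QuotientGroup.mk (g * h))) =
        fun h : H => f₀ (g * h) / fiberIntegral H ρ f₀ (QuotientGroup.mk g) := by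
      funext h; rw [QuotientGroup.mk_mul_of_mem g h.2]
    rw [heq, integral_div, ← fiberIntegral_mk, div_self (hpos _).ne']

/-- **A chosen Bruhat function** for `H ≤ G` and `ρ`. [folklore] -/
def bruhatFunction : G → ℝ := Classical.choose (exists_isBruhatFunction H ρ hH)

/-- The chosen Bruhat function is one. [folklore] -/
theorem isBruhatFunction_bruhatFunction : IsBruhatFunction H ρ (bruhatFunction H ρ hH) :=
  Classical.choose_spec (exists_isBruhatFunction H ρ hH)

end Construction

/-! ### Integrals over `G ⧸ H` as integrals over `G` against a Bruhat function -/

section Weil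

variable {G : Type*} [Group G] [TopologicalSpace G] [IsTopologicalGroup G] [LocallyCompactSpace G]
  [SecondCountableTopology G] [T2Space G] [MeasurableSpace G] [BorelSpace G]
  (H : Subgroup G) [hH : IsClosed (H : Set G)]
  (ρ : Measure H) [ρ.IsMulLeftInvariant] [SFinite ρ] [IsFiniteMeasureOnCompacts ρ]
  [MeasurableSpace (G ⧸ H)] [BorelSpace (G ⧸ H)]
  (μ : Measure (G ⧸ H)) [SMulInvariantMeasure G (G ⧸ H) μ] [IsFiniteMeasureOnCompacts μ]
  (ν : Measure G) [IsHaarMeasure ν]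

omit [LocallyCompactSpace G] [SecondCountableTopology G] [T2Space G] hH [SFinite ρ]
  [IsFiniteMeasureOnCompacts ρ] [MeasurableSpace (G ⧸ H)] [BorelSpace (G ⧸ H)] in
/-- The fibre integral of `β · (u ∘ π)` is `u` for a Bruhat function `β` (`ℝ≥0∞` version). [folklore] -/
theorem IsBruhatFunction.fiberLIntegral_ofReal_mul_comp_mk {β : G → ℝ} (hβ : IsBruhatFunction H ρ β)
    (u : G ⧸ H → ℝ≥0∞) (x : G ⧸ H) :
    fiberLIntegral H ρ (fun g => ENNReal.ofReal (β g) * u (QuotientGroup.mk g)) x = u x := by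
  obtain ⟨g, rfl⟩ := QuotientGroup.mk_surjective x
  rw [fiberLIntegral_mk]
  have h1 : ∀ h : H, ENNReal.ofReal (β (g * h)) * u (QuotientGroup.mk (g * (h : G))) =
      ENNReal.ofReal (β (g * h)) * u (QuotientGroup.mk g) := fun h => by
    rw [QuotientGroup.mk_mul_of_mem g h.2]
  simp_rw [h1]
  have hm : Measurable fun h : H => ENNReal.ofReal (β (g * h)) :=
    (hβ.continuous.measurable.comp ((measurable_const_mul g).comp measurable_subtype_coe)).ennreal_ofReal
  rw [lintegral_mul_const _ hm, ← ofReal_integral_eq_lintegral_ofReal (hβ.integrable_fiber g)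
      (Eventually.of_forall fun h => hβ.nonneg _), hβ.integral_fiber g, ENNReal.ofReal_one, one_mul]

/-- **Integration over the quotient through a Bruhat function**, `ℝ≥0∞` version: for every Borel
`u : G ⧸ H → [0, ∞]`, `∫_{G ⧸ H} u dμ = c ∫_G β(g) u(gH) dν(g)` with `c = unfoldingConstant H ρ μ ν`
(Weil's formula `lintegral_fiberLIntegral_eq_mul_lintegral` for `β · (u ∘ π)`, whose fibre integrals
are `u`; Folland (1995), (2.59)/(2.52) with Prop. 2.48). [cite: Folland1995, §2.6 Thm. 2.49] -/
theorem IsBruhatFunction.lintegral_eq_mul_lintegral {β : G → ℝ} (hβ : IsBruhatFunction H ρ β)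
    {u : G ⧸ H → ℝ≥0∞} (hu : Measurable u) :
    ∫⁻ x, u x ∂μ = unfoldingConstant H ρ μ ν *
      ∫⁻ g, ENNReal.ofReal (β g) * u (QuotientGroup.mk g) ∂ν := by
  have hf : Measurable fun g => ENNReal.ofReal (β g) * u (QuotientGroup.mk g) :=
    hβ.continuous.measurable.ennreal_ofReal.mul (hu.comp (QuotientGroup.continuous_mk (N := H)).measurable)
  rw [← lintegral_fiberLIntegral_eq_mul_lintegral H ρ μ ν hf]
  exact lintegral_congr fun x => (hβ.fiberLIntegral_ofReal_mul_comp_mk H ρ u x).symm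

/-- **`β · (u ∘ π) ∈ L¹(G)` for `u ∈ L¹(G ⧸ H)`** (strongly measurable), with
`c ∫_G β |u ∘ π| dν = ∫ |u| dμ`. [folklore] -/
theorem IsBruhatFunction.integrable_mul_comp_mk {β : G → ℝ} (hβ : IsBruhatFunction H ρ β)
    {E : Type*} [NormedAddCommGroup E] [NormedSpace ℝ E]
    {u : G ⧸ H → E} (hum : StronglyMeasurable u) (hu : Integrable u μ)
    (hc : unfoldingConstant H ρ μ ν ≠ 0) :
    Integrable (fun g => β g • u (QuotientGroup.mk g)) ν := by
  refine ⟨(hβ.continuous.aestronglyMeasurable).smul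
    (hum.comp_measurable (QuotientGroup.continuous_mk (N := H)).measurable).aestronglyMeasurable, ?_⟩
  have h := hβ.lintegral_eq_mul_lintegral H ρ μ ν (u := fun x => ‖u x‖ₑ) hum.enorm
  have h1 : ∀ g, ‖β g • u (QuotientGroup.mk g)‖ₑ = ENNReal.ofReal (β g) * ‖u (QuotientGroup.mk g)‖ₑ := by
    intro g
    rw [enorm_smul, Real.enorm_eq_ofReal (hβ.nonneg g)]
  change ∫⁻ g, ‖β g • u (QuotientGroup.mk g)‖ₑ ∂ν < ∞
  simp_rw [h1]
  have hfin : unfoldingConstant H ρ μ ν * ∫⁻ g, ENNReal.ofReal (β g) * ‖u (QuotientGroup.mk g)‖ₑ ∂ν < ∞ := by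
    rw [← h]; exact hu.2
  by_contra htop
  rw [not_lt, top_le_iff] at htop
  rw [htop, ENNReal.mul_top (by exact_mod_cast hc)] at hfin
  exact lt_irrefl _ hfin

end Weil

end Literature.MeasureTheory.Group
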